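import Mathlib
import Literature.NumberTheory.EllipticCurves.ThreeTorsionIrreducibleInertiaShapeKodairaThreeProofs
import Literature.NumberTheory.Automorphic.BCDTModularityModPProofs
import Literature.NumberTheory.EllipticCurves.HasseWeilGoodReductionProofs
import Literature.NumberTheory.ModularSymbols.CuspidalHomologyShiftNorm
import HarnessLib

/-!
# ModularJacobianNormImageSerreWeight

Topic `Literature/NumberTheory/EllipticCurves`. Named literature fact(s) relocated by the gate from `Summits/BirchSwinnertonDyer/BirchSwinnertonDyer/Theorems/TameQuarticManinParityNormImageAvoidsThreeOfSerreWeight.lean`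
(accept-time relocation of `[cite]`d propositions written inline in a Summits proposal; human ruling 2026-08-15).
Sources: DarmonDiamondTaylor1995, Harrison2011X0108, Serre1987.

* `Literature.NumberTheory.EllipticCurves.normImage_modThree_serreWeight_le_four`
-/

namespace Literature.NumberTheory.EllipticCurves

open scoped NumberField Polynomial Valued
open Polynomial IsDedekindDomain NumberField Field ValuativeRel
open Literature.NumberTheory.EllipticCurves.ModularForms Literature.NumberTheory.ModularSymbols
open Literature.NumberTheory.GaloisRepresentations Rat.HeightOneSpectrum
open Literature.NumberTheory.GaloisRepresentations.IsNonarchimedeanLocalField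

/-- **Irreducible mod-`3` systems in the `t`-norm image of `H₁(X₀(N), ℤ)` (`9 ∣ N`) have Serre weight `≤ 4`**
(named fact). Let `9 ∣ N`, `Λ = H₁(X₀(N), ℤ)`, `Nm = 1 + t + t²` (`t : z ↦ z + 1/3`), and let
`ρ̄ : Γ_ℚ → GL₂(𝔽₃)` be continuous, IRREDUCIBLE (no `ρ̄`-stable line), with Frobenius characteristic polynomials
`X² − a_p X + p (mod 3)` at the primes `p ∤ 3N` for integers `a_p`. There is a finite set `S₀` of primes such
that: if some `z ∈ Λ` has `Nm z ∉ 3Λ` and `Nm((T_p − a_p)^k z) ∈ 3Λ` for all `p ∈ S₀`, `p ≠ 3` (the system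
`(a_p mod 3)` occurs in `NmΛ/(NmΛ ∩ 3Λ)`), then for every algebraically closed discrete `k` of characteristic `3` and
`j : 𝔽₃ → k` there are a local restriction datum `loc` at `3` and a residue embedding `ι` with Serre weight
`k(ρ̄ ⊗ k) ≤ 4`. PRINT ASSEMBLY: `NmΛ = π^*π_*Λ ≅ π_*Λ ⊆ H₁(X₀(N/3), ℤ)` `𝕋′`-equivariantly (Harrison 2011 §2,
`π : X₀(N) → X₀(N)/⟨t⟩ ≅ X₀(N/3)`; Atkin–Lehner 1970 §3), so the system is a weight-`2` mod-`3` system of level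
`N/3` (Brauer–Nesbitt for lattices, Serre *Linear Representations* §15.2); it is carried by an eigenform `g` of
level `N/3` (Deligne–Serre 1974, Lemme 6.11) with `tr ρ̄_g(Frob_p) ≡ a_p(g)` (Darmon–Diamond–Taylor Thm. 3.1(a)); for
`S₀` separating the finitely many such `ρ̄_g` (Chebotarev, Brauer–Nesbitt) `ρ̄ ≅ ρ̄_g`; and since `9 ∤ N/3`,
`ρ_g|G₃` is finite flat (`3 ∤ N/3`, Thm. 3.1(f)) or ordinary (`3 ∥ N/3`, Thm. 3.1(g), `ℓ = 3` odd), so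
`ρ̄|I₃` is finite flat or `(ω·λ ∗; 0 λ′)` and Serre's recipe gives `k(ρ̄) ∈ {2, 4}` (Serre 1987 §2.2–2.4; Edixhoven
1992 Thms. 2.5–2.6). [cite: DarmonDiamondTaylor1995, Thm. 3.1 (a),(f),(g) (p. 86) and Thm. 1.29 (p. 37)]
[cite: Serre1987, §2.2–2.4] [cite: Harrison2011X0108, §2] [file NumberTheory/EllipticCurves/ModularJacobianNormImageSerreWeight] -/
def normImage_modThree_serreWeight_le_four : Prop :=
  ∀ (N : ℕ) [NeZero N] (h9 : 3 ^ 2 ∣ N) (ρ : ModPGaloisRep ℚ (ZMod 3) 2),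
    (∀ L : Submodule (ZMod 3) (Fin 2 → ZMod 3),
      (∀ (g : Field.absoluteGaloisGroup ℚ) (x : Fin 2 → ZMod 3), x ∈ L →
        ((ρ g : GL (Fin 2) (ZMod 3)) : Matrix (Fin 2) (Fin 2) (ZMod 3)).mulVec x ∈ L) → L = ⊥ ∨ L = ⊤) →
    ∀ (a : ℕ → ℤ),
      (∀ (v : HeightOneSpectrum (𝓞 ℚ)), ¬ ((primesEquiv v : Nat.Primes) : ℕ) ∣ 3 * N →
        ∀ 𝔓 ∈ v.primesAbove, ∀ φ : Field.absoluteGaloisGroup ℚ, IsArithFrobAt (𝓞 ℚ) φ 𝔓 →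
          ((ρ φ : GL (Fin 2) (ZMod 3)) : Matrix (Fin 2) (Fin 2) (ZMod 3)).charpoly =
            X ^ 2 - C ((a ((primesEquiv v : Nat.Primes) : ℕ) : ℤ) : ZMod 3) * X +
              C ((((primesEquiv v : Nat.Primes) : ℕ) : ℕ) : ZMod 3)) →
      ∃ S₀ : Finset ℕ,
        (∃ z : periodHomologyHecke N,
          (¬ ∃ u : periodHomologyHecke N, normInt N h9 z = (3 : ℕ) • u) ∧
          ∀ (p : ℕ) (hp : p.Prime), p ≠ 3 → p ∈ S₀ →
            ∃ (k : ℕ) (u : periodHomologyHecke N),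
              normInt N h9 ((HeckeRing0.T N 2 p hp - (a p : HeckeRing0 N 2)) ^ k • z) = (3 : ℕ) • u) →
        ∀ (k : Type) [Field k] [TopologicalSpace k] [DiscreteTopology k] [CharP k 3] [IsAlgClosed k]
          (j : ZMod 3 →+* k) (hj : Continuous j),
          ∃ (loc : ModPGaloisRep.LocalRestrictionAt 3 (FramedRep.baseChange j hj ρ))
            (ι : absIntegers 𝒪[loc.F] loc.F ⧸ absMaximalIdeal loc.F →+* k),
            ModPGaloisRep.serreWeight 3 (FramedRep.baseChange j hj ρ) loc ι ≤ 4

end Literature.NumberTheory.EllipticCurves
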